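import Summits.AtomisticToContinuum.Crystallization.Theorems.FrustratedLawDichotomyStrainedPatchHomConvexSegmentW45

/-!
# The EXTERIOR (ring) form of the convex-well bound: an energy floor GROWING with the distance from the reference shuffle
# (real side of the «energy-exterior» ring certificate of the ξ-eliminating U-tree leaf; 27623 `(H) HomFloor (1/625)`, hcp half)

decomp-a2c hand-2 g29 (crux `AperiodicFrustratedLawGap`, stmt-AtomisticToContinuum-27623; BUDGET-F, critic rows 1077 / 1083 (D), architecture «R» of
`HOME/decomp-a2c-hand-2/g29/BUDGET-F-hand2.md`: ξ is ELIMINATED per `U`-cell by ring certificates about the relaxed shuffle).  The landed convex-well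
bound (`…HomConvexWell.sub_le_of_uniformlyConvex_segment`, hand-1 g26) completes the square: value `V`, slope `G`, uniform convexity `λ` along the
segment give the floor `V − G²/(2λ)` INDEPENDENTLY of the end point — the right bound near the minimiser, useless away from it.  On the EXTERIOR of the
ball of radius `r₁ ≥ G/λ` the same three data give the floor `V − G r₁ + (λ/2) r₁²`, which GROWS with `r₁` (the tangent parabola `−G t + (λ/2) t²`
is non-decreasing from its vertex `t = G/λ` on): one certificate per `U`-cell then certifies the energy disjunct on the whole complement of the tight
cube / force annulus, where the energy is at least `(λ/2) r₁² − G r₁` above the (sub-floor) sheet value.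

* §1 ★ `exterior_le_of_uniformlyConvex_segment` / `exterior_floor_of_uniformlyConvex_segment` (normed space, one segment);
* §2 ★★ `sum_exterior_of_curvature` (label sum of piecewise-`C²` pair terms; the hypotheses of `…HomConvexSegment.sum_floor_of_curvature` verbatim plus
  `0 ≤ G`, `G ≤ λ r₁`, `r₁ ≤ ‖Δ‖`);
* §3 ★★★ `hcpShifted_exterior_of_curvature` (any potential) and `hcpShifted_exterior_W45` (record potential, regularity discharged exactly as in
  `…HomConvexSegmentW45.hcpShifted_floor_W45`), plus the shuffle-distance form `hcpShifted_exterior_W45_of_shuffle_dist`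
  (`r₁ ≤ (3/4)‖ξ − ξ₀‖` suffices since `‖U − 1‖ ≤ 1/4`).

NO definitions; 0 sorry; standard axioms; no instances / notation / `#eval`.  `--supports stmt-AtomisticToContinuum-27623`.
-/

noncomputable section

namespace Summit.AtomisticToContinuum.Crystallization.Theorems.FrustratedLawDichotomyStrainedPatchHomConvexExterior

open scoped BigOperators
open Summit.AtomisticToContinuum.Crystallization.Theorems.FrustratedLawDichotomyStrainedPatchTaylorChord (segR segG segGd)
open Summit.AtomisticToContinuum.Crystallization.Theorems.FrustratedLawDichotomyStrainedPatchHomConvexWell (le_of_uniformlyConvex_segment)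
open Summit.AtomisticToContinuum.Crystallization.Theorems.FrustratedLawDichotomyStrainedPatchHomConvexSegment
  (slope_growth_of_curvature_sum hasDerivAt_sum_segment norm_shuffle_segment_le)
open Summit.AtomisticToContinuum.Crystallization.Theorems.ChargedEnergyGapNegative (E3)
open Summit.AtomisticToContinuum.Crystallization.Theorems.FrustratedLawDichotomyStrainedPatchHomSplit (latPt hexFrame hcpShift)
open Summit.AtomisticToContinuum.Crystallization.Theorems.FrustratedLawDichotomyStrainedPatchEnvelopeTaylor (Wrec)
open Summit.AtomisticToContinuum.Crystallization.Theorems.FrustratedLawDichotomyStrainedPatchTaylorLeaves (junctions differentiableAt_Wrec)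
open Summit.AtomisticToContinuum.Crystallization.Theorems.FrustratedLawDichotomyStrainedPatchTaylorRegular
  (continuousOn_deriv_Wrec differentiableAt_deriv_Wrec)
open Summit.AtomisticToContinuum.Crystallization.Theorems.FrustratedLawDichotomyStrainedPatchHomLatticeBoxHcp (norm_shifted_gt)
open Summit.AtomisticToContinuum.Crystallization.Theorems.FrustratedLawDichotomyStrainedPatchHomPolar (norm_apply_ge_of_norm_sub_one_le)

/-! ## §1. One segment in a normed space -/

variable {E : Type*} [NormedAddCommGroup E] [NormedSpace ℝ E]

/-- The tangent parabola is non-decreasing beyond its vertex: `0 ≤ G ≤ λ r₁ ≤ λ r` ⟹ `−G r₁ + (λ/2) r₁² ≤ −G r + (λ/2) r²`. [arithmetic] -/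
theorem parabola_mono {lam G r₁ r : ℝ} (hr₁ : G ≤ lam * r₁) (hr : r₁ ≤ r) (hG : 0 ≤ G) (hlam : 0 < lam) :
    -G * r₁ + lam / 2 * r₁ ^ 2 ≤ -G * r + lam / 2 * r ^ 2 := by
  have h1 : 0 ≤ r - r₁ := sub_nonneg.2 hr
  have h0 : 0 ≤ r₁ := by nlinarith
  have h2 : 0 ≤ lam / 2 * (r + r₁) - G := by nlinarith
  nlinarith [mul_nonneg h1 h2]

/-- ★ **EXTERIOR FORM OF THE CONVEX-WELL BOUND.**  With `g t := f (x₀ + t • v)` differentiable on `[0,1]`, slope growth `g′ t ≥ g′ 0 + λ‖v‖² t`,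
centre slope `|g′ 0| ≤ G‖v‖`, `0 ≤ G ≤ λ r₁` and `‖v‖ ≥ r₁`: `f (x₀ + v) ≥ f x₀ − G r₁ + (λ/2) r₁²` — a floor that GROWS with the exterior radius
`r₁`. [folklore] -/
theorem exterior_le_of_uniformlyConvex_segment {f : E → ℝ} {x₀ v : E} {g' : ℝ → ℝ} {lam G r₁ : ℝ} (hlam : 0 < lam) (hG0 : 0 ≤ G)
    (hg : ∀ t ∈ Set.Icc (0 : ℝ) 1, HasDerivAt (fun t : ℝ => f (x₀ + t • v)) (g' t) t)
    (hmono : ∀ t ∈ Set.Icc (0 : ℝ) 1, g' 0 + lam * ‖v‖ ^ 2 * t ≤ g' t) (hG : |g' 0| ≤ G * ‖v‖) (hr₁ : G ≤ lam * r₁) (hv : r₁ ≤ ‖v‖) :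
    f x₀ - G * r₁ + lam / 2 * r₁ ^ 2 ≤ f (x₀ + v) := by
  have h := le_of_uniformlyConvex_segment hg hmono
  have hr : -(G * ‖v‖) ≤ g' 0 := (abs_le.1 hG).1
  have hp := parabola_mono hr₁ hv hG0 hlam
  linarith

/-- ★ Value form: certified `V ≤ f x₀`, `G`, `λ`, and the exterior radius `r₁` give `V − G r₁ + (λ/2) r₁² ≤ f (x₀ + v)`. [formal bookkeeping] -/
theorem exterior_floor_of_uniformlyConvex_segment {f : E → ℝ} {x₀ v : E} {g' : ℝ → ℝ} {lam G V r₁ : ℝ} (hlam : 0 < lam) (hG0 : 0 ≤ G)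
    (hV : V ≤ f x₀) (hg : ∀ t ∈ Set.Icc (0 : ℝ) 1, HasDerivAt (fun t : ℝ => f (x₀ + t • v)) (g' t) t)
    (hmono : ∀ t ∈ Set.Icc (0 : ℝ) 1, g' 0 + lam * ‖v‖ ^ 2 * t ≤ g' t) (hG : |g' 0| ≤ G * ‖v‖) (hr₁ : G ≤ lam * r₁) (hv : r₁ ≤ ‖v‖) :
    V - G * r₁ + lam / 2 * r₁ ^ 2 ≤ f (x₀ + v) := by
  have := exterior_le_of_uniformlyConvex_segment hlam hG0 hg hmono hG hr₁ hv
  linarith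

/-! ## §2. Label sums of piecewise-`C²` pair terms -/

/-- ★★ **EXTERIOR ENERGY FLOOR FROM VALUE, SLOPE AND CURVATURE-SUM DATA** (the hypotheses of `…HomConvexSegment.sum_floor_of_curvature` verbatim,
plus `0 ≤ G ≤ λ r₁ ≤ λ‖Δ‖`): `V − G r₁ + (λ/2) r₁² ≤ Σ_i W‖p_i + Δ‖`. [folklore chaining] -/
theorem sum_exterior_of_curvature {ι : Type*} (S : Finset ι) (p : ι → EuclideanSpace ℝ (Fin 3)) {Δ : EuclideanSpace ℝ (Fin 3)} (hΔ : Δ ≠ 0)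
    {W W₁ : ℝ → ℝ} (J : Finset ℝ) {a b lam G V r₁ : ℝ} (ha : 0 < a) (hlam : 0 < lam) (hG0 : 0 ≤ G)
    (hW : ∀ r, a ≤ r → r ≤ b → HasDerivAt W (W₁ r) r) (hcont : ContinuousOn W₁ (Set.Icc a b))
    (hdiff : ∀ r, a < r → r < b → r ∉ J → HasDerivAt W₁ (deriv W₁ r) r)
    (htube : ∀ i ∈ S, ∀ s ∈ Set.Icc (0 : ℝ) 1, a ≤ ‖p i + s • Δ‖ ∧ ‖p i + s • Δ‖ ≤ b)
    (hcurv : ∀ s ∈ Set.Ioo (0 : ℝ) 1, (∀ i ∈ S, a < segR (p i) Δ s ∧ segR (p i) Δ s < b ∧ segR (p i) Δ s ∉ J) →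
      lam * ‖Δ‖ ^ 2 ≤ ∑ i ∈ S, segGd W₁ (p i) Δ s)
    (hV : V ≤ ∑ i ∈ S, W ‖p i‖) (hG : |∑ i ∈ S, segG W₁ (p i) Δ 0| ≤ G * ‖Δ‖) (hr₁ : G ≤ lam * r₁) (hv : r₁ ≤ ‖Δ‖) :
    V - G * r₁ + lam / 2 * r₁ ^ 2 ≤ ∑ i ∈ S, W ‖p i + Δ‖ := by
  have hmono := slope_growth_of_curvature_sum S p hΔ J ha hcont hdiff htube hcurv
  have hV' : V ≤ (fun x : EuclideanSpace ℝ (Fin 3) => ∑ i ∈ S, W ‖p i + x‖) 0 := by simpa using hV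
  have key := exterior_floor_of_uniformlyConvex_segment (f := fun x : EuclideanSpace ℝ (Fin 3) => ∑ i ∈ S, W ‖p i + x‖) (x₀ := 0) (v := Δ)
    (g' := fun s => ∑ i ∈ S, segG W₁ (p i) Δ s) hlam hG0 hV'
    (fun s hs => by simpa using hasDerivAt_sum_segment S p Δ ha hW htube hs)
    (fun s hs => by have := hmono s hs; linarith) hG hr₁ hv
  simpa using key

/-! ## §3. The hcp shifted-family sum -/

/-- ★★★ **EXTERIOR ξ-FLOOR FOR THE hcp SHIFTED-FAMILY SUM** (any pair potential `W` with the piecewise-`C²` data; reference shuffle `ξ₀`, target `ξ`,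
`Δ = U(ξ − ξ₀)`): certified VALUE `V ≤ Σ_b W‖p_b‖`, SLOPE `G ≥ 0`, CURVATURE-SUM floor `λ > 0` along the segment, and an exterior radius `r₁` with
`G ≤ λ r₁ ≤ λ‖Δ‖` give `V − G r₁ + (λ/2) r₁² ≤ Σ_b W‖latPt U hexFrame b + U(hcpShift + ξ)‖`. [folklore chaining] -/
theorem hcpShifted_exterior_of_curvature (B : Finset (Fin 3 → ℤ)) (U : E3 →L[ℝ] E3) (ξ₀ ξ : E3) (hξ : U (ξ - ξ₀) ≠ 0)
    {W W₁ : ℝ → ℝ} (J : Finset ℝ) {a b lam G V r₁ : ℝ} (ha : 0 < a) (hlam : 0 < lam) (hG0 : 0 ≤ G)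
    (hW : ∀ r, a ≤ r → r ≤ b → HasDerivAt W (W₁ r) r) (hcont : ContinuousOn W₁ (Set.Icc a b))
    (hdiff : ∀ r, a < r → r < b → r ∉ J → HasDerivAt W₁ (deriv W₁ r) r)
    (htube : ∀ bb ∈ B, ∀ s ∈ Set.Icc (0 : ℝ) 1,
      a ≤ ‖latPt U hexFrame bb + U (hcpShift + ξ₀) + s • U (ξ - ξ₀)‖ ∧ ‖latPt U hexFrame bb + U (hcpShift + ξ₀) + s • U (ξ - ξ₀)‖ ≤ b)
    (hcurv : ∀ s ∈ Set.Ioo (0 : ℝ) 1,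
      (∀ bb ∈ B, a < segR (latPt U hexFrame bb + U (hcpShift + ξ₀)) (U (ξ - ξ₀)) s ∧
        segR (latPt U hexFrame bb + U (hcpShift + ξ₀)) (U (ξ - ξ₀)) s < b ∧ segR (latPt U hexFrame bb + U (hcpShift + ξ₀)) (U (ξ - ξ₀)) s ∉ J) →
      lam * ‖U (ξ - ξ₀)‖ ^ 2 ≤ ∑ bb ∈ B, segGd W₁ (latPt U hexFrame bb + U (hcpShift + ξ₀)) (U (ξ - ξ₀)) s)
    (hV : V ≤ ∑ bb ∈ B, W ‖latPt U hexFrame bb + U (hcpShift + ξ₀)‖)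
    (hG : |∑ bb ∈ B, segG W₁ (latPt U hexFrame bb + U (hcpShift + ξ₀)) (U (ξ - ξ₀)) 0| ≤ G * ‖U (ξ - ξ₀)‖)
    (hr₁ : G ≤ lam * r₁) (hv : r₁ ≤ ‖U (ξ - ξ₀)‖) :
    V - G * r₁ + lam / 2 * r₁ ^ 2 ≤ ∑ bb ∈ B, W ‖latPt U hexFrame bb + U (hcpShift + ξ)‖ := by
  have key := sum_exterior_of_curvature B (fun bb => latPt U hexFrame bb + U (hcpShift + ξ₀)) hξ J ha hlam hG0 hW hcont hdiff htube hcurv hV hG hr₁ hv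
  have hpt : ∀ bb : Fin 3 → ℤ, latPt U hexFrame bb + U (hcpShift + ξ₀) + U (ξ - ξ₀) = latPt U hexFrame bb + U (hcpShift + ξ) := by
    intro bb
    rw [add_assoc, ← map_add]
    congr 2
    abel
  simpa only [hpt] using key

/-- ★★★ **EXTERIOR ξ-FLOOR FOR THE hcp SHIFTED-FAMILY SUM OF `W₄₅`** (regularity discharged as in `…HomConvexSegmentW45.hcpShifted_floor_W45`).
For `‖U − 1‖ ≤ 1/4`, `‖ξ₀‖, ‖ξ‖ ≤ 1/4`, any label finset `B`, `0 < λ`, `0 ≤ G ≤ λ r₁`, `r₁ ≤ ‖U(ξ − ξ₀)‖` and the three certificates VALUE / SLOPE /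
CURVATURE-SUM at the reference shuffle `ξ₀`: `V − G r₁ + (λ/2) r₁² ≤ Σ_b W₄₅‖latPt U hexFrame b + U(hcpShift + ξ)‖`. [folklore chaining] -/
theorem hcpShifted_exterior_W45 (B : Finset (Fin 3 → ℤ)) {U : E3 →L[ℝ] E3} (hU : ‖U - 1‖ ≤ 1 / 4) {ξ₀ ξ : E3} (hξ₀ : ‖ξ₀‖ ≤ 1 / 4)
    (hξ : ‖ξ‖ ≤ 1 / 4) {lam G V r₁ : ℝ} (hlam : 0 < lam) (hG0 : 0 ≤ G)
    (hcurv : ∀ s ∈ Set.Ioo (0 : ℝ) 1,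
      (∀ bb ∈ B, segR (latPt U hexFrame bb + U (hcpShift + ξ₀)) (U (ξ - ξ₀)) s ∉ junctions) →
      lam * ‖U (ξ - ξ₀)‖ ^ 2 ≤ ∑ bb ∈ B, segGd (deriv Wrec) (latPt U hexFrame bb + U (hcpShift + ξ₀)) (U (ξ - ξ₀)) s)
    (hV : V ≤ ∑ bb ∈ B, Wrec ‖latPt U hexFrame bb + U (hcpShift + ξ₀)‖)
    (hG : |∑ bb ∈ B, segG (deriv Wrec) (latPt U hexFrame bb + U (hcpShift + ξ₀)) (U (ξ - ξ₀)) 0| ≤ G * ‖U (ξ - ξ₀)‖)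
    (hr₁ : G ≤ lam * r₁) (hv : r₁ ≤ ‖U (ξ - ξ₀)‖) :
    V - G * r₁ + lam / 2 * r₁ ^ 2 ≤ ∑ bb ∈ B, Wrec ‖latPt U hexFrame bb + U (hcpShift + ξ)‖ := by
  by_cases hΔ : U (ξ - ξ₀) = 0
  · -- degenerate direction: then `r₁ ≤ 0`, hence `G = 0`, `r₁ = 0`
    rw [hΔ, norm_zero] at hv
    have hr0 : 0 ≤ r₁ := by nlinarith
    have hr : r₁ = 0 := le_antisymm hv hr0
    have hUeq : U (hcpShift + ξ) = U (hcpShift + ξ₀) := by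
      have : hcpShift + ξ = (hcpShift + ξ₀) + (ξ - ξ₀) := by abel
      rw [this, map_add, hΔ, add_zero]
    rw [hUeq, hr]
    simpa using hV
  set p : (Fin 3 → ℤ) → E3 := fun bb => latPt U hexFrame bb + U (hcpShift + ξ₀) with hp
  set Δ : E3 := U (ξ - ξ₀) with hΔdef
  set bhi : ℝ := (∑ bb ∈ B, ‖p bb‖) + ‖Δ‖ + 1 with hbhi
  have hseg : ∀ bb : Fin 3 → ℤ, ∀ s : ℝ, p bb + s • Δ = latPt U hexFrame bb + U (hcpShift + (ξ₀ + s • (ξ - ξ₀))) := by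
    intro bb s
    simp only [hp, hΔdef, map_add, map_smul]
    abel
  have htube : ∀ bb ∈ B, ∀ s ∈ Set.Icc (0 : ℝ) 1, 3 / 8 ≤ ‖p bb + s • Δ‖ ∧ ‖p bb + s • Δ‖ ≤ bhi := by
    intro bb hbb s hs
    constructor
    · rw [hseg]
      exact (norm_shifted_gt hU (norm_shuffle_segment_le hξ₀ hξ hs) bb).le
    · have h1 : ‖p bb + s • Δ‖ ≤ ‖p bb‖ + ‖Δ‖ := by
        calc ‖p bb + s • Δ‖ ≤ ‖p bb‖ + ‖s • Δ‖ := norm_add_le _ _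
          _ ≤ ‖p bb‖ + ‖Δ‖ := by
              rw [norm_smul, Real.norm_eq_abs, abs_of_nonneg hs.1]
              nlinarith [norm_nonneg Δ, hs.2]
      have h2 : ‖p bb‖ ≤ ∑ bb ∈ B, ‖p bb‖ := Finset.single_le_sum (fun _ _ => norm_nonneg _) hbb
      rw [hbhi]; linarith
  have ha : (0 : ℝ) < 3 / 8 := by norm_num
  have hW : ∀ r, (3 : ℝ) / 8 ≤ r → r ≤ bhi → HasDerivAt Wrec (deriv Wrec r) r := fun r hr _ =>
    (differentiableAt_Wrec (ha.trans_le hr).ne').hasDerivAt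
  have hcont : ContinuousOn (deriv Wrec) (Set.Icc (3 / 8) bhi) := continuousOn_deriv_Wrec.mono fun r hr => ha.trans_le hr.1
  have hdiff : ∀ r, (3 : ℝ) / 8 < r → r < bhi → r ∉ junctions → HasDerivAt (deriv Wrec) (deriv (deriv Wrec) r) r :=
    fun r hr _ hJ => (differentiableAt_deriv_Wrec (ha.trans hr) hJ).hasDerivAt
  have hcurv' : ∀ s ∈ Set.Ioo (0 : ℝ) 1, (∀ bb ∈ B, 3 / 8 < segR (p bb) Δ s ∧ segR (p bb) Δ s < bhi ∧ segR (p bb) Δ s ∉ junctions) →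
      lam * ‖Δ‖ ^ 2 ≤ ∑ bb ∈ B, segGd (deriv Wrec) (p bb) Δ s :=
    fun s hs hgood => hcurv s hs fun bb hbb => (hgood bb hbb).2.2
  exact hcpShifted_exterior_of_curvature B U ξ₀ ξ hΔ junctions ha hlam hG0 hW hcont hdiff htube hcurv' hV hG hr₁ hv

/-- ★ **Shuffle-distance form**: since `‖U − 1‖ ≤ 1/4` gives `‖U(ξ − ξ₀)‖ ≥ (3/4)‖ξ − ξ₀‖`, an exterior radius with `r₁ ≤ (3/4)‖ξ − ξ₀‖` (read off the
ξ-BOX geometry by the kernel leaf) suffices. [folklore chaining] -/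
theorem hcpShifted_exterior_W45_of_shuffle_dist (B : Finset (Fin 3 → ℤ)) {U : E3 →L[ℝ] E3} (hU : ‖U - 1‖ ≤ 1 / 4) {ξ₀ ξ : E3}
    (hξ₀ : ‖ξ₀‖ ≤ 1 / 4) (hξ : ‖ξ‖ ≤ 1 / 4) {lam G V r₁ : ℝ} (hlam : 0 < lam) (hG0 : 0 ≤ G)
    (hcurv : ∀ s ∈ Set.Ioo (0 : ℝ) 1,
      (∀ bb ∈ B, segR (latPt U hexFrame bb + U (hcpShift + ξ₀)) (U (ξ - ξ₀)) s ∉ junctions) →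
      lam * ‖U (ξ - ξ₀)‖ ^ 2 ≤ ∑ bb ∈ B, segGd (deriv Wrec) (latPt U hexFrame bb + U (hcpShift + ξ₀)) (U (ξ - ξ₀)) s)
    (hV : V ≤ ∑ bb ∈ B, Wrec ‖latPt U hexFrame bb + U (hcpShift + ξ₀)‖)
    (hG : |∑ bb ∈ B, segG (deriv Wrec) (latPt U hexFrame bb + U (hcpShift + ξ₀)) (U (ξ - ξ₀)) 0| ≤ G * ‖U (ξ - ξ₀)‖)
    (hr₁ : G ≤ lam * r₁) (hdist : r₁ ≤ 3 / 4 * ‖ξ - ξ₀‖) :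
    V - G * r₁ + lam / 2 * r₁ ^ 2 ≤ ∑ bb ∈ B, Wrec ‖latPt U hexFrame bb + U (hcpShift + ξ)‖ := by
  have h34 := norm_apply_ge_of_norm_sub_one_le hU (ξ - ξ₀)
  exact hcpShifted_exterior_W45 B hU hξ₀ hξ hlam hG0 hcurv hV hG hr₁ (by linarith)

end Summit.AtomisticToContinuum.Crystallization.Theorems.FrustratedLawDichotomyStrainedPatchHomConvexExterior

end
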